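/-
Copyright (c) 2026 the pub-hodgecm-mathlib formalisation cell (harness21).  Prover seat hodgecm-mathlib-K2E3-p06 (g5), Track B «K2-LIT», engine E3, unit U4 «Keys»; deal (D61)
LINE LEAD of the open leaf (U4f-χ₁-ram-one), design D-I, plan DESIGN-B v1 step (B3) «THE FOUR CELL VALUES OF AN `(I, θ)`-TYPE VECTOR» on `U(Φ₃)(L⁺_v)`;
2026-09-04.  KERNEL module: THEOREMS ONLY (no definition, no named fact, no `sorry`, no instance, no notation).
-/
import Summits.HodgeConjecture.HodgeConjecture.Theorems.K2E3IwahoriCellMembership           -- ★-filed (B2) (this seat): `mem_of_height_le_one`, `weyl_mul_mul_weyl_inv_mem_of_height_lt_one`, `theta_eq_one_of_mem_N`; brings ★ letters (i) (`theta_conj_eq_one`), the frame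
import Summits.HodgeConjecture.HodgeConjecture.Theorems.F0P3cStCharTSBigCellFactorisation    -- ★ B4∕FILE 1 (LH4): `toFun_weylElt_mul_eq_of_isUnit` (the far-out formula for ANY section), `exists_unipotentU_entries_eq`, `neg_one_mem_normOneUnits`
import Summits.HodgeConjecture.HodgeConjecture.Theorems.F0P3cStCharTSLocalRingNormDictionary  -- ★ DICT (LH4): `isUnit_iff_ne_zero_localRing`, `prod_normAbs_eq_zero_iff`
import HarnessLib

/-!
# K2 ∕ E3 «EllipticInputs», unit U4 «Keys» — (U4f-χ₁-ram-one) step (B3) of DESIGN-B: THE CELL VALUES OF AN `(I, θ)`-EIGEN SECTION OF `i(χ₁, χ₂)` ON `w₀ N` AND ON `N̄ = w₀ N w₀⁻¹`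
# (A1) `m ≤ 1`: `f(w₀u) = f(w₀)`; (A2) `m > 1`: `f(w₀u) = χ₁(σb)⁻¹χ₂(−1)‖b‖⁻¹·f(1)`; (A3) `m < 1`: `f(w₀uw₀⁻¹) = f(1)`; (A4) `m ≥ 1`: `f(w₀uw₀⁻¹) = χ₁(σb)⁻¹χ₂(−1)‖b‖⁻¹·f(w₀)`
# [Casselman1995 §6.4, Prop. 1.3.3; Keys1984 §3–§4; Roche1998 §3–§4; Rogawski1990 §4.5]

Cell hodgecm-mathlib (D-0151), FLOOR 0, Track B «K2-LIT», engine E3, crux item H413 = stmt-HodgeConjecture-24833 (route `HCCMUnconditional`, no route verbs); target BY NAME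
the OPEN leaf `…K2E3EllipticInputs.U4Keys.sig_K2E3KeysThmTwoContractingRamifiedCharOne` (U4Keys ED. 7; cand v5 leaf (U4f-χ₁-ram-one-d0B)), design D-I, plan `DESIGN-B-v1`
(`K2/K2E3-p06/g5/DESIGN-B-v1-BranchBDepthZero.K2E3-p06-g5.md`) step (B3).  Author K2E3-p06 (g5), line lead (D61).  `--supports stmt-HodgeConjecture-24833 --as helper`; THEOREMS ONLY.
NOT THE PAYER: the input of (B4), the Branch-B determinant identity `G₁G₂ = μ(B₀)μ(B_{-1})`.

THE POINT.  `f` a section of `i(χ₁, χ₂)` (★ `cmPrincipalSeries` carrier) which is `(I, θ)`-EIGEN, read POINTWISE: `f(g b) = θ(b) f(g)` for `b ∈ I = K₀ ⊓ K₁` (the (G3)-frame Iwahori; §0 derives this from `b·f = θ(b)•f`), `θ(g) = χ₁(g₀₀)` (when a unit;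
the depth-zero Iwahori character ★ Z2A-1∕3b) — e.g. the type vector of ★ (B1).  `u ∈ N(L⁺_v)`, `b = u₀₂`, height `m(u) = Π_{w′}|b_{w′}| = ‖b‖`, weight `c(b) = χ₁(σ b)⁻¹ · χ₂(−1) · ‖b‖⁻¹`
(the integrand of ★ `toFun_weylElt_mul_eq_of_isUnit`).  The spherical file ★ `K2E3SphericalCellFunction` computed `f(w₀u)` for a `K_v`-FIXED `f`; here `f` is only `I`-eigen, and BOTH
charts `w₀N` (for `Λ_1`) and `N̄ = w₀Nw₀⁻¹` (for `Λ_{w₀⁻¹}`) are needed, with DIFFERENT thresholds (`≤ 1 ∕ > 1` resp. `< 1 ∕ ≥ 1`):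
* §1 **`toFun_weyl_mul_eq_of_height_le_one`** (A1) — `m(u) ≤ 1 ⟹ f(w₀u) = f(w₀)` (`u ∈ I` ★ (B2), `θ(u) = 1` ★ (B2) §3).
* §2 **`toFun_weyl_mul_mul_weyl_inv_eq_of_height_lt_one`** (A3) — `m(u) < 1 ⟹ f(w₀uw₀⁻¹) = f(1)` (`w₀uw₀⁻¹ ∈ I` ★ (B2) §2, `θ(w₀uw₀⁻¹) = 1` ★ `theta_conj_eq_one`).
* (sequel `K2E3TypeVectorCellValuesFar`) §3 **`toFun_weyl_mul_eq_of_one_lt_height`** (A2) — `m(u) > 1 ⟹ f(w₀u) = c(b)·f(1)`: ★ far-out formula `f(w₀u) = c(b)·f(w₀u′w₀⁻¹)`, `u′` of entries `(ab⁻¹, b⁻¹)` has `m(u′) = m(u)⁻¹ < 1`, §2.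
* (sequel) §4 **`toFun_weyl_mul_mul_weyl_inv_eq_of_one_le_height`** (A4) — `m(u) ≥ 1 ⟹ f(w₀uw₀⁻¹) = c(b)·f(w₀)`: the far-out formula applied to the SECTION `w₀⁻¹·f` (`(w₀⁻¹·f)(g) = f(g w₀⁻¹)`),
  `w₀⁻¹w₀⁻¹ = 1`, and §1 for `u′` (`m(u′) ≤ 1`).
HONEST LABEL: HC_CM is proved only modulo the 7 printed citations (2 remaining named inputs: hLiu418 = stmt-HodgeConjecture-24832, h413 = stmt-HodgeConjecture-24833)
until rung 0 closes; count-neutral — this file does NOT pay the leaf; no printed citation is discharged.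

## References
* [Casselman1995] W. Casselman, *Introduction to the theory of admissible representations of `p`-adic reductive groups* (1995), Prop. 1.3.3, §6.4 pp. 62–64.
* [Keys1984] D. Keys, *Principal series representations of special unitary groups over local fields*, Compositio Math. 51 (1984), §3–§4.
* [Roche1998] A. Roche, Ann. Sci. ÉNS (4) 31 (1998), §3–§4 (`χ̃`-spherical vectors and their support).
* [Rogawski1990] J. D. Rogawski, *Automorphic Representations of Unitary Groups in Three Variables* (1990), §1.10 p. 9, §4.5 p. 45, §12.1 p. 171.
-/

set_option autoImplicit false
-- the mandated namespace has the single-problem summit's repeated segment (`HodgeConjecture.HodgeConjecture`)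
set_option linter.dupNamespace false

noncomputable section

open NumberField IsDedekindDomain MeasureTheory
open scoped Matrix MatrixGroups WithZero Valued NNReal
open Literature.NumberTheory Literature.NumberTheory.Automorphic Literature.NumberTheory.Automorphic.UnitaryGroup
open Literature.NumberTheory.Rogawski1990 Literature.NumberTheory.GaloisRepresentations Literature.NumberTheory.GaloisRepresentations.IsNonarchimedeanLocalField

namespace Summit.HodgeConjecture.HodgeConjecture.Cruxes.H413.K2E3TypeVectorCellValues

open Summit.HodgeConjecture.HodgeConjecture.Cruxes.H413
open Summit.HodgeConjecture.HodgeConjecture.Cruxes.H413.K2E3DepthZeroIwahoriCharacterCM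
open Summit.HodgeConjecture.HodgeConjecture.Cruxes.H413.K2E3BranchALettersCM
open Summit.HodgeConjecture.HodgeConjecture.Cruxes.H413.K2E3IwahoriCellMembership

variable (L : Type) [Field L] [NumberField L] [IsCMField L] (v : HeightOneSpectrum (𝓞 ↥(maximalRealSubfield L)))
  (w : PlacesOver L v) (hw : IsCMField.complexConj L • w.1 = w.1)
  (eA : Gqs L v ≃ₜ* ↥(unitaryGroupOfForm (galAdicCompletionMap (L := L) (IsCMField.complexConj L) hw) ((StdForm.antidiagonal 3).over (w.1.adicCompletion L))))
  (heA : ∀ g : Gqs L v,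
    ((eA g : ↥(unitaryGroupOfForm (galAdicCompletionMap (L := L) (IsCMField.complexConj L) hw) ((StdForm.antidiagonal 3).over (w.1.adicCompletion L)))) :
        GL (Fin 3) (w.1.adicCompletion L)) =
      ((localNonsplitEquiv (IsCMField.complexConj L) (qsForm L) (IsCMField.complexConj_ne_one L) w hw g :
        ↥(unitaryGroupOfForm (galAdicCompletionMap (L := L) (IsCMField.complexConj L) hw) (placeForm (qsForm L) w.1))) : GL (Fin 3) (w.1.adicCompletion L)))
  {ϖ : w.1.adicCompletion L} (hϖ : Valued.v ϖ = WithZero.exp (-1 : ℤ))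
  (g₁ : GL (Fin 3) (w.1.adicCompletion L)) (hg₁ : (g₁ : Matrix (Fin 3) (Fin 3) (w.1.adicCompletion L)) = Matrix.diagonal ![(1 : w.1.adicCompletion L), 1, ϖ])
  (K0 K1 I : Subgroup (Gqs L v))
  (hK0 : K0 = ((glInt 3 (w.1.adicCompletion L)).subgroupOf
    (unitaryGroupOfForm (galAdicCompletionMap (L := L) (IsCMField.complexConj L) hw) ((StdForm.antidiagonal 3).over (w.1.adicCompletion L)))).comap
      eA.toMulEquiv.toMonoidHom)
  (hK1 : K1 = (((glInt 3 (w.1.adicCompletion L)).map (MulAut.conj g₁).toMonoidHom).subgroupOf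
    (unitaryGroupOfForm (galAdicCompletionMap (L := L) (IsCMField.complexConj L) hw) ((StdForm.antidiagonal 3).over (w.1.adicCompletion L)))).comap
      eA.toMulEquiv.toMonoidHom)
  (hI : I = K0 ⊓ K1)
  (w₀ : ↥(unitaryGroupOfForm (conjLocal L (IsCMField.complexConj L) v) (cmLocalForm L 3 v))) (hw₀ : Units.val (w₀ : GL (Fin 3) (LocalRing L v)) = cmLocalForm L 3 v)
  (χ₁ : (LocalRing L v)ˣ →* ℂˣ) (χ₂ : ↥(normOneUnits (conjLocal L (IsCMField.complexConj L) v)) →* ℂˣ)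
  (f : haveI := locallyCompactSpace_cmBorelU L 3 v
    Representation.SmoothInd (cmBorelTriple L 3 v).P
      (Representation.twist
        (((Representation.trivial ℂ ↥(torusU (conjLocal L (IsCMField.complexConj L) v) (cmLocalForm L 3 v)) ℂ).twist
          (cmTorusCharPair L v χ₁ χ₂)).comp (cmBorelTriple L 3 v).proj) (rootDeltaChar (cmBorelTriple L 3 v).P)))

/-! ## §0 The eigen-relation at a point -/

open Classical in
set_option synthInstance.maxHeartbeats 400000 in
set_option maxHeartbeats 3000000 in
-- the `SmoothInd` carrier of ★ `cmPrincipalSeries` (class of ★ Z2-gen `toFun_mul_eq_of_eigen`)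
/-- Pointwise form of `b·f = θ(b)•f`: **`f(g b) = θ(b) · f(g)`** for `b ∈ I` (`(b·f)(g) = f(g b)`, ★ `toFun_smoothIndRep_apply`). [cite: Roche1998, §3] [cite: Casselman1995, §3.3] -/
theorem toFun_mul_eq_theta_mul
    (heig : ∀ b : ↥(unitaryGroupOfForm (conjLocal L (IsCMField.complexConj L) v) (cmLocalForm L 3 v)), (b : Gqs L v) ∈ I → haveI := locallyCompactSpace_cmBorelU L 3 v
      Representation.smoothIndRep (cmBorelTriple L 3 v).P _ b f =
        (if h : IsUnit (((b : GL (Fin 3) (LocalRing L v)) : Matrix (Fin 3) (Fin 3) (LocalRing L v)) 0 0) then ((χ₁ h.unit : ℂˣ) : ℂ) else 0) • f)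
    {b : ↥(unitaryGroupOfForm (conjLocal L (IsCMField.complexConj L) v) (cmLocalForm L 3 v))} (hb : (b : Gqs L v) ∈ I) (g : ↥(unitaryGroupOfForm (conjLocal L (IsCMField.complexConj L) v) (cmLocalForm L 3 v))) :
    f.toFun (g * b) = (if h : IsUnit (((b : GL (Fin 3) (LocalRing L v)) : Matrix (Fin 3) (Fin 3) (LocalRing L v)) 0 0) then ((χ₁ h.unit : ℂˣ) : ℂ) else 0) * f.toFun g := by
  haveI := locallyCompactSpace_cmBorelU L 3 v
  have h := congrArg (fun φ => Representation.SmoothInd.toFun φ g) (heig b hb)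
  simp only [Representation.toFun_smoothIndRep_apply, Representation.SmoothInd.toFun_smul, Pi.smul_apply, smul_eq_mul] at h
  exact h

/-! ## §1 (A1) On `w₀ · B₀`: `f(w₀ u) = f(w₀)` -/

open Classical in
include hw heA hϖ hg₁ hK0 hK1 hI in
set_option synthInstance.maxHeartbeats 400000 in
set_option maxHeartbeats 3000000 in
-- the `SmoothInd` carrier of ★ `cmPrincipalSeries` (class of §0)
/-- **(A1) `m(u) ≤ 1 ⟹ f(w₀ u) = f(w₀)`** for an `(I, θ)`-eigen section `f`: `u ∈ I` (★ (B2) `mem_of_height_le_one`) and `θ(u) = 1` (★ (B2) `theta_eq_one_of_mem_N`).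
[cite: Casselman1995, §6.4 p. 63] [cite: Roche1998, §3] -/
theorem toFun_weyl_mul_eq_of_height_le_one
    (heig : ∀ b : ↥(unitaryGroupOfForm (conjLocal L (IsCMField.complexConj L) v) (cmLocalForm L 3 v)), (b : Gqs L v) ∈ I → ∀ g : ↥(unitaryGroupOfForm (conjLocal L (IsCMField.complexConj L) v) (cmLocalForm L 3 v)),
      f.toFun (g * b) = (if h : IsUnit (((b : GL (Fin 3) (LocalRing L v)) : Matrix (Fin 3) (Fin 3) (LocalRing L v)) 0 0) then ((χ₁ h.unit : ℂˣ) : ℂ) else 0) * f.toFun g)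
    (u : ↥(cmBorelTriple L 3 v).N)
    (hu : (∏ w' : PlacesOver L v, normAbs (w'.1.adicCompletion L) ((((((u : ↥(unitaryGroupOfForm (conjLocal L (IsCMField.complexConj L) v) (cmLocalForm L 3 v)))) : GL (Fin 3) (LocalRing L v)) : Matrix (Fin 3) (Fin 3) (LocalRing L v)) 0 2) w')) ≤ 1) :
    f.toFun (w₀ * (u : ↥(unitaryGroupOfForm (conjLocal L (IsCMField.complexConj L) v) (cmLocalForm L 3 v)))) = f.toFun w₀ := by
  have huI : ((u : ↥(unitaryGroupOfForm (conjLocal L (IsCMField.complexConj L) v) (cmLocalForm L 3 v))) : Gqs L v) ∈ I :=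
    mem_of_height_le_one L v w hw eA heA hϖ g₁ hg₁ K0 K1 I hK0 hK1 hI (cmBorelTriple L 3 v) rfl (n := (u : ↥(unitaryGroupOfForm (conjLocal L (IsCMField.complexConj L) v) (cmLocalForm L 3 v)))) u.2 hu
  have hθ : (if h : IsUnit (((((u : ↥(unitaryGroupOfForm (conjLocal L (IsCMField.complexConj L) v) (cmLocalForm L 3 v))) : GL (Fin 3) (LocalRing L v)) : Matrix (Fin 3) (Fin 3) (LocalRing L v)) 0 0)) then ((χ₁ h.unit : ℂˣ) : ℂ) else 0) = 1 :=
    theta_eq_one_of_mem_N L v (cmBorelTriple L 3 v) rfl χ₁ (n := (u : ↥(unitaryGroupOfForm (conjLocal L (IsCMField.complexConj L) v) (cmLocalForm L 3 v)))) u.2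
  rw [heig _ huI w₀, hθ, one_mul]

/-! ## §2 (A3) On `N̄ ∩ I`: `f(w₀ u w₀⁻¹) = f(1)` -/

open Classical in
include hw heA hϖ hg₁ hK0 hK1 hI hw₀ in
set_option synthInstance.maxHeartbeats 400000 in
set_option maxHeartbeats 3000000 in
-- the `SmoothInd` carrier of ★ `cmPrincipalSeries` (class of §0)
/-- **(A3) `m(u) < 1 ⟹ f(w₀ u w₀⁻¹) = f(1)`** for an `(I, θ)`-eigen section `f`: `w₀uw₀⁻¹ ∈ I` (★ (B2) `weyl_mul_mul_weyl_inv_mem_of_height_lt_one`), `θ(w₀uw₀⁻¹) = 1` (★ letters (i)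
`theta_conj_eq_one`, `w₀⁻¹ = w₀`), and `f(1·k) = θ(k) f(1)`. [cite: Casselman1995, §6.4 p. 63] [cite: Roche1998, §3–§4] [cite: BruhatTits1972, (4.4.4)] -/
theorem toFun_weyl_mul_mul_weyl_inv_eq_of_height_lt_one
    (heig : ∀ b : ↥(unitaryGroupOfForm (conjLocal L (IsCMField.complexConj L) v) (cmLocalForm L 3 v)), (b : Gqs L v) ∈ I → ∀ g : ↥(unitaryGroupOfForm (conjLocal L (IsCMField.complexConj L) v) (cmLocalForm L 3 v)),
      f.toFun (g * b) = (if h : IsUnit (((b : GL (Fin 3) (LocalRing L v)) : Matrix (Fin 3) (Fin 3) (LocalRing L v)) 0 0) then ((χ₁ h.unit : ℂˣ) : ℂ) else 0) * f.toFun g)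
    (u : ↥(cmBorelTriple L 3 v).N)
    (hu : (∏ w' : PlacesOver L v, normAbs (w'.1.adicCompletion L) ((((((u : ↥(unitaryGroupOfForm (conjLocal L (IsCMField.complexConj L) v) (cmLocalForm L 3 v)))) : GL (Fin 3) (LocalRing L v)) : Matrix (Fin 3) (Fin 3) (LocalRing L v)) 0 2) w')) < 1) :
    f.toFun (w₀ * (u : ↥(unitaryGroupOfForm (conjLocal L (IsCMField.complexConj L) v) (cmLocalForm L 3 v))) * w₀⁻¹) = f.toFun 1 := by
  -- `w₀⁻¹ = w₀` (`eA w₀ = w`, `w · w = 1`; products read in `Gqs L v` for `map_mul`)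
  have hww : @HMul.hMul (Gqs L v) (Gqs L v) (Gqs L v) instHMul w₀ w₀ = 1 :=
    eA.injective (by rw [map_mul, map_one, map_weyl_eq_weylLongU L v w hw eA heA w₀ hw₀, weylLongU_mul_weylLongU])
  have hinv : w₀⁻¹ = w₀ := inv_eq_of_mul_eq_one_right hww
  rw [hinv]
  have hkI : ((w₀ * (u : ↥(unitaryGroupOfForm (conjLocal L (IsCMField.complexConj L) v) (cmLocalForm L 3 v))) * w₀ :
      ↥(unitaryGroupOfForm (conjLocal L (IsCMField.complexConj L) v) (cmLocalForm L 3 v))) : Gqs L v) ∈ I :=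
    weyl_mul_mul_weyl_mem_of_height_lt_one L v w hw eA heA hϖ g₁ hg₁ K0 K1 I hK0 hK1 hI (cmBorelTriple L 3 v) rfl w₀ hw₀
      (n := (u : ↥(unitaryGroupOfForm (conjLocal L (IsCMField.complexConj L) v) (cmLocalForm L 3 v)))) u.2 hu
  have hθ : (if h : IsUnit ((((w₀ * (u : ↥(unitaryGroupOfForm (conjLocal L (IsCMField.complexConj L) v) (cmLocalForm L 3 v))) * w₀ :
      ↥(unitaryGroupOfForm (conjLocal L (IsCMField.complexConj L) v) (cmLocalForm L 3 v))) : GL (Fin 3) (LocalRing L v)) : Matrix (Fin 3) (Fin 3) (LocalRing L v)) 0 0)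
      then ((χ₁ h.unit : ℂˣ) : ℂ) else 0) = 1 :=
    theta_conj_eq_one L v w hw eA heA (cmBorelTriple L 3 v) rfl w₀ hw₀ χ₁ (n := (u : ↥(unitaryGroupOfForm (conjLocal L (IsCMField.complexConj L) v) (cmLocalForm L 3 v)))) u.2
  have h := heig _ hkI 1
  rw [one_mul, hθ, one_mul] at h
  exact h

end Summit.HodgeConjecture.HodgeConjecture.Cruxes.H413.K2E3TypeVectorCellValues

end
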